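import Summits.HodgeConjecture.HodgeConjecture.Theorems.LinearSystemTorelliMiddleDivisorSupportFourfoldOfDominantQbarEnvelope
import Summits.HodgeConjecture.HodgeConjecture.Theorems.LinearSystemTorelliMiddleDivisorSupportFourfoldStubDominantEnvelope
import Summits.HodgeConjecture.HodgeConjecture.Theorems.LinearSystemTorelliMiddleDivisorSupportFourfoldStubFiniteMonodromyOfTypeStability
import Literature.AlgebraicGeometry.HodgeTheory.SpreadingOutQbarFamilyProofs
import Literature.AlgebraicGeometry.FundamentalGroup.RiemannExistenceQbarDescentProofs
import Literature.AlgebraicGeometry.FundamentalGroup.RiemannExistenceSeparatingLowDim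
import Literature.AlgebraicGeometry.HodgeTheory.AlgebraicCyclesDefinedOverQbarProofs
import Literature.AlgebraicGeometry.HodgeTheory.IsoTransport
import Literature.AlgebraicGeometry.HodgeTheory.ArapuraSurfaceFibredFourfoldsProofs
import HarnessLib

/-!
# Crux `LinearSystemTorelli.MiddleDivisorSupportFourfold` on the Hodge-level-zero sector

Sub-goal of crux stmt-HodgeConjecture-2409 (`Theses.LinearSystemTorelli.MiddleDivisorSupportFourfold`:
every rational `(2,2)`-class on a smooth projective complex fourfold lies in `N¹H⁴`), line
`IdeatorFiveSketch` (skeleton v17, `Cruxes/MiddleDivisorSupportFourfold/Lines/IdeatorFiveSketch.lean`).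

The line closes the crux from four registered stubs: the transcendence kernel **T** (A'': the
continuations of a rational `(2,2)`-class along loops at a `ℚ̄`-generic point of a `ℚ̄`-family of
fourfolds are again of type `(2,2)` — OPEN, Voisin's question on the field of definition of Hodge
loci), the covering debt C1'' (algebraic separating functions on finite coverings of smooth affine
`ℂ`-schemes of relative dimension `≥ 2` = Riemann existence, SGA1 XII 5.1), Deligne's partie fixe D
(= route item stmt-HodgeConjecture-16363) and the sector stub E (≡ HC/`ℚ̄`(·,2), stmt-11596 slice).

This file records WHERE THE KERNEL IS VOID: on the **Hodge-level-zero sector** — smooth projective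
fourfolds `X` with `H⁴(X(ℂ); ℂ) = H^{2,2}`, i.e. `h^{4,0}(X) = h^{3,1}(X) = 0`, spelled
`∀ c : H⁴(X(ℂ); ℂ), IsOfHodgeType 4 X 4 2 2 c` — T holds for the trivial reason that EVERY class on
the spread fibre `𝒳_s ≅ X` is of type `(2,2)`, so the line's composition runs unconditionally in T:

* `linearSystemTorelli_mem_supportedClasses_one_of_levelZero` — for such `X`, every rational class
  `c ∈ H⁴(X(ℂ); ℂ)` lies in `N¹H⁴(X)`, GIVEN Riemann existence with `ℚ̄`-descent (the named fact
  `FundamentalGroup.riemannExistence_qbarDescent_of_finiteIndex`, C), Deligne's partie fixe (the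
  named fact `deligne_globalInvariantCycles`, D) and `ℚ̄`-rational divisor support in codimension 2
  (E, for one `σ : ℚ̄ →+* ℂ`): spread `X` over `ℚ̄` (PROVED), finite monodromy from type stability
  (PROVED, p127337: Hodge–Riemann for the relative hyperplane class + lattice finiteness), dominant
  `ℚ̄`-envelope (PROVED, p119525), divisor support upstairs (E), dominant pull-back (PROVED, p117963);
* `linearSystemTorelli_levelZero_of_hodgeNumbers` — the sector hypothesis from Hodge numbers: in a
  Hodge model `A` of `X` with `dim H^{4,0} = dim H^{3,1} = 0`, every class of `H⁴` is of type
  `(2,2)` (Hodge symmetry + the Hodge decomposition of the model: `H^{2,2} = H⁴`,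
  `linearSystemTorelli_hodgePQ_two_two_eq_top`);
* `linearSystemTorelli_mem_supportedClasses_one_of_levelZero_of_items` — the same with the debts
  named as the line carries them today: C from the registered stub C1'' (relative dimension `≥ 2`;
  dimension `≤ 1` is the tree's `algebraicSeparating_of_smoothOfRelativeDimension_le_one`) by
  `riemannExistence_qbarDescent_of_finiteIndex_of_algebraicSeparating`, D as the route decl
  `Theses.LinearSystemTorelli.DeligneGlobalInvariantCycles` (stmt-16363), E from
  `Theses.PeriodDeficiency.HodgeConjectureQbar` (stmt-11596) by the discharged Charles–Schnell fact.

So on the level-zero sector the crux (= HC(4,2) there, since `N¹ ∩ H^{2,2}_ℚ` is algebraic by the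
route's `DivisorInduction` + Lefschetz `(1,1)`) is reduced to HC/`ℚ̄`(·,2) and stmt-16363 modulo
Riemann existence in relative dimension `≥ 2` — the classical principle "Hodge classes spanning all
of `H^{2p}` are absolute, and for absolute classes HC over `ℚ̄` suffices" (Voisin 2007, Prop. 0.7 /
§3), kernel-checked through the line's own machinery with no conjugate varieties. The sector is the
locus `h^{4,0} = h^{3,1} = 0` where the generalised Hodge / Bloch conjectures predict `H⁴ = N²H⁴`
outright; HC(4,2) is not known on it in general (it is known when `CH₀` is supported in dimension
`≤ 3`, Bloch–Srinivas).

[cite: Voisin2007HodgeLoci, Prop. 0.7, §3] [cite: CharlesSchnell2014Notes, Thm 11.3.19]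
[cite: SGA1, Exp. XII Thm. 5.1] [cite: DeligneHodgeII1971, Thm. 4.1.1]
-/

noncomputable section

-- every declaration of this problem lives in `Summit.HodgeConjecture.HodgeConjecture.Theorems`
set_option linter.dupNamespace false

namespace Summit.HodgeConjecture.HodgeConjecture.Theorems

open CategoryTheory AlgebraicGeometry Topology
open Literature.AlgebraicGeometry Literature.AlgebraicGeometry.Motives
open Literature.AlgebraicGeometry.HodgeTheory
open Literature.AlgebraicTopology.SingularHomology

/-- **Level zero is transported along isomorphisms**: if `H⁴(X) = H^{2,2}` and `e : X ≅ Y`, then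
`H⁴(Y) = H^{2,2}` (`IsOfHodgeType.of_map_iso`: a class whose pull-back `e^* β` is `(2,2)` is `(2,2)`).
[cite: VoisinHodgeI2002, §7.1.1] -/
theorem linearSystemTorelli_levelZero_of_iso {X Y : SchemeOver ℂ} (e : X ≅ Y)
    (hall : ∀ c : complexBetti X 4, IsOfHodgeType 4 X 4 2 2 c) :
    ∀ β : complexBetti Y 4, IsOfHodgeType 4 Y 4 2 2 β :=
  fun β ↦ IsOfHodgeType.of_map_iso e (hall (complexBetti.map e.hom 4 β))

/-- **The dominant `ℚ̄`-envelope of a rational class on a level-zero fourfold** (A + B of the line,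
with A automatic): for `σ : ℚ̄ →+* ℂ`, GIVEN Riemann existence with `ℚ̄`-descent (C) and Deligne's
partie fixe (D), every rational class `c ∈ H⁴(X(ℂ); ℂ)` on a smooth projective fourfold with
`H⁴ = H^{2,2}` is `ι^* c'` for a rational `(2,2)`-class `c'` on some smooth projective `W₀ ⊗_σ ℂ`
with `X → W₀` dominant: spread `X ≅ 𝒳_s` over `ℚ̄` with `s` generic
(`spreadingOut_smoothProjective_qbarFamily_holds`), every continuation of `(e⁻¹)^* c` is of type
`(2,2)` (level zero, transported along `e`), hence the monodromy orbit is finite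
(`linearSystemTorelli_finite_setOf_isContinuationAlong_of_forall_isOfHodgeType`, p127337), hence the
dominant envelope (`stub_dominantEnvelopeOfFiniteMonodromy`, p119525), precomposed with `e`.
[cite: Voisin2007HodgeLoci, Prop. 0.7, §3] [cite: CharlesSchnell2014Notes, Thm 11.3.19] -/
theorem linearSystemTorelli_dominantQbarEnvelope_of_levelZero (σ : AlgebraicClosure ℚ →+* ℂ)
    (hC : Literature.AlgebraicGeometry.FundamentalGroup.riemannExistence_qbarDescent_of_finiteIndex)
    (hD : deligne_globalInvariantCycles) ⦃X : SchemeOver ℂ⦄ (hX : IsSmoothProjective 4 X)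
    (hlev : ∀ c : complexBetti X 4, IsOfHodgeType 4 X 4 2 2 c) (c : complexBetti X 4)
    (hc : IsRationalClass c) :
    ∃ (m : ℕ) (W₀ : SchemeOver (AlgebraicClosure ℚ)) (ι : X ⟶ (baseChangeHom σ).obj W₀)
      (c' : complexBetti ((baseChangeHom σ).obj W₀) 4),
      IsSmoothProjective m ((baseChangeHom σ).obj W₀) ∧
      DenseRange (ι.left ≫ baseChangeHomFst σ W₀).base ∧
      IsRationalClass c' ∧ IsOfHodgeType m ((baseChangeHom σ).obj W₀) 4 2 2 c' ∧
      complexBetti.map ι 4 c' = c := by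
  obtain ⟨𝒳₀, S₀, f₀, s, h𝒳₀, hS₀, hirr, hsm, hf, hgen, ⟨e⟩⟩ :=
    spreadingOut_smoothProjective_qbarFamily_holds σ hX
  -- level zero on the spread fibre `𝒳_s ≅ X`
  have hlev' : ∀ β : complexBetti (fiberOver ((baseChangeHom σ).map f₀) s) 4,
      IsOfHodgeType 4 (fiberOver ((baseChangeHom σ).map f₀) s) 4 2 2 β :=
    linearSystemTorelli_levelZero_of_iso e hlev
  -- finite monodromy orbit of the transported class (A, from type stability — automatic here)
  have hfin : {β : complexBetti (fiberOver ((baseChangeHom σ).map f₀) s) 4 |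
      ∃ γ : Path s s, IsContinuationAlong γ (complexBetti.map e.inv 4 c) β}.Finite :=
    linearSystemTorelli_finite_setOf_isContinuationAlong_of_forall_isOfHodgeType σ f₀ 4 2 hf h𝒳₀ hS₀
      hirr hsm s (complexBetti.map e.inv 4 c) (hc.map _) (fun _ β _ ↦ hlev' β)
  -- the dominant envelope of the transported class (B), precomposed with `e`
  obtain ⟨m, W₀, ι, c', hW, hdom, hc', hh', hmap⟩ :=
    stub_dominantEnvelopeOfFiniteMonodromy hC hD σ f₀ 4 2 h𝒳₀ hS₀ hirr hsm hf s hgen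
      (complexBetti.map e.inv 4 c) (hc.map _) (hlev' _) hfin
  refine ⟨m, W₀, e.hom ≫ ι, c', hW, ?_, hc', hh', ?_⟩
  · have hsurj : Function.Surjective e.hom.left.base := by
      have : IsIso e.hom.left := inferInstance
      exact e.hom.left.surjective
    have : ((e.hom ≫ ι).left ≫ baseChangeHomFst σ W₀).base =
        e.hom.left.base ≫ (ι.left ≫ baseChangeHomFst σ W₀).base := rfl
    rw [this, TopCat.coe_comp]
    exact hdom.comp hsurj.denseRange (ι.left ≫ baseChangeHomFst σ W₀).base.hom.continuous
  · rw [complexBetti.map_comp, ModuleCat.comp_apply, hmap]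
    exact e.complexBetti_map_hom_map_inv 4 c

/-- **The crux on the Hodge-level-zero sector, modulo the line's debts C, D, E.** For
`σ : ℚ̄ →+* ℂ`, GIVEN Riemann existence with `ℚ̄`-descent (C), Deligne's partie fixe (D) and
`ℚ̄`-rational divisor support of rational `(2,2)`-classes on smooth projective `W₀ ⊗_σ ℂ` in
codimension 2 (the registered sector stub E at `σ`): on every smooth projective complex fourfold `X`
with `H⁴(X(ℂ); ℂ) = H^{2,2}` (`h^{4,0} = h^{3,1} = 0`), every rational class `c ∈ H⁴` lies in
`N¹H⁴(X)` — the dominant `ℚ̄`-envelope (`linearSystemTorelli_dominantQbarEnvelope_of_levelZero`), E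
upstairs, and the dominant pull-back `Nʳ → N¹` (p117963). The transcendence kernel T of the line is
void on this sector. [cite: Voisin2007HodgeLoci, Prop. 0.7, §3] [cite: GrothendieckTopology1969, §1] -/
theorem linearSystemTorelli_mem_supportedClasses_one_of_levelZero (σ : AlgebraicClosure ℚ →+* ℂ)
    (hC : Literature.AlgebraicGeometry.FundamentalGroup.riemannExistence_qbarDescent_of_finiteIndex)
    (hD : deligne_globalInvariantCycles)
    (hE : ∀ ⦃m : ℕ⦄ (W₀ : SchemeOver (AlgebraicClosure ℚ)),
      IsSmoothProjective m ((baseChangeHom σ).obj W₀) →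
      ∀ (c' : complexBetti ((baseChangeHom σ).obj W₀) 4), IsRationalClass c' →
        IsOfHodgeType m ((baseChangeHom σ).obj W₀) 4 2 2 c' →
          ∃ Z₀ : Set W₀.left, IsClosed Z₀ ∧ Z₀ ≠ Set.univ ∧
            complexBetti.restrictCompl ((baseChangeHom σ).obj W₀)
              ((baseChangeHomFst σ W₀).base ⁻¹' Z₀) 4 c' = 0)
    ⦃X : SchemeOver ℂ⦄ (hX : IsSmoothProjective 4 X)
    (hlev : ∀ c : complexBetti X 4, IsOfHodgeType 4 X 4 2 2 c) (c : complexBetti X 4)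
    (hc : IsRationalClass c) : c ∈ supportedClasses X 4 1 := by
  obtain ⟨m, W₀, ι, c', hW, hdom, hc', hh', hmap⟩ :=
    linearSystemTorelli_dominantQbarEnvelope_of_levelZero σ hC hD hX hlev c hc
  obtain ⟨Z₀, hZ₀, hZ₀ne, hd⟩ := hE W₀ hW c' hc' hh'
  rw [← hmap]
  exact linearSystemTorelli_map_mem_supportedClasses_one_of_preimage_ne_univ hX ι
    (hZ₀.preimage (baseChangeHomFst σ W₀).continuous)
    (linearSystemTorelli_preimage_ne_univ_of_denseRange hdom hZ₀ hZ₀ne) hd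

/-- **The crux on the level-zero sector from the line's REGISTERED open stubs other than T** — C1''
(algebraic separating functions on finite coverings of smooth irreducible affine `ℂ`-schemes of
relative dimension `≥ 2`; relative dimension `≤ 1` is the tree's
`FundamentalGroup.algebraicSeparating_of_smoothOfRelativeDimension_le_one`), D as the route decl
`Theses.LinearSystemTorelli.DeligneGlobalInvariantCycles` (stmt-HodgeConjecture-16363) and E: on a
smooth projective fourfold with `H⁴ = H^{2,2}`, every rational class in `H⁴` lies in `N¹H⁴`.
[cite: Voisin2007HodgeLoci, Prop. 0.7, §3] [cite: SGA1, Exp. XII Thm. 5.1 (p. 333)] -/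
theorem linearSystemTorelli_mem_supportedClasses_one_of_levelZero_of_stubs
    (hC1 : ∀ (n : ℕ) (S : SchemeOver ℂ), IsAffine S.left → SmoothOfRelativeDimension (n + 2) S.hom →
      IrreducibleSpace S.left →
      ∀ (T : Type) [TopologicalSpace T] (q : T → ComplexPoints S) (_ : IsCoveringMap q)
        (_ : ∀ t, (q ⁻¹' {t}).Finite) (P₀ : ComplexPoints S),
        ∃ (h : T → ℂ) (F : Polynomial Γ(S.left, ⊤)), Continuous h ∧ F ≠ 0 ∧
          (∀ t, (F.map ((q t).evalRingHom ⊤ trivial)).eval (h t) = 0) ∧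
          Set.InjOn h (q ⁻¹' {P₀}))
    (hD : Theses.LinearSystemTorelli.DeligneGlobalInvariantCycles)
    (hE : ∀ (σ : AlgebraicClosure ℚ →+* ℂ) ⦃m : ℕ⦄ (W₀ : SchemeOver (AlgebraicClosure ℚ)),
      IsSmoothProjective m ((baseChangeHom σ).obj W₀) →
      ∀ (c' : complexBetti ((baseChangeHom σ).obj W₀) 4), IsRationalClass c' →
        IsOfHodgeType m ((baseChangeHom σ).obj W₀) 4 2 2 c' →
          ∃ Z₀ : Set W₀.left, IsClosed Z₀ ∧ Z₀ ≠ Set.univ ∧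
            complexBetti.restrictCompl ((baseChangeHom σ).obj W₀)
              ((baseChangeHomFst σ W₀).base ⁻¹' Z₀) 4 c' = 0) :
    ∀ ⦃X : SchemeOver ℂ⦄, IsSmoothProjective 4 X →
      (∀ c : complexBetti X 4, IsOfHodgeType 4 X 4 2 2 c) →
        ∀ (c : complexBetti X 4), IsRationalClass c → c ∈ supportedClasses X 4 1 := by
  obtain ⟨σ⟩ := exists_ringHom_algebraicClosure_rat_complex
  -- C from C1'' + the tree's relative dimension `≤ 1`
  have hC1' : ∀ (S : SchemeOver ℂ), IsAffine S.left → AlgebraicGeometry.Smooth S.hom →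
      IrreducibleSpace S.left →
      ∀ (T : Type) [TopologicalSpace T] (q : T → ComplexPoints S) (_ : IsCoveringMap q)
        (_ : ∀ t, (q ⁻¹' {t}).Finite) (P₀ : ComplexPoints S),
        ∃ (h : T → ℂ) (F : Polynomial Γ(S.left, ⊤)), Continuous h ∧ F ≠ 0 ∧
          (∀ t, (F.map ((q t).evalRingHom ⊤ trivial)).eval (h t) = 0) ∧
          Set.InjOn h (q ⁻¹' {P₀}) := by
    intro S hS hsm hirr T _ q hq hfin P₀
    haveI := hS; haveI := hsm; haveI := hirr
    obtain ⟨n, hn⟩ := Motives.exists_smoothOfRelativeDimension_of_smooth S.hom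
    rcases Nat.lt_or_ge n 2 with hlt | hge
    · exact Literature.AlgebraicGeometry.FundamentalGroup.algebraicSeparating_of_smoothOfRelativeDimension_le_one
        (Nat.lt_succ_iff.mp hlt) S q hq hfin P₀
    · obtain ⟨k, rfl⟩ := Nat.exists_eq_add_of_le' hge
      exact hC1 k S hS hn hirr T q hq hfin P₀
  have hC : Literature.AlgebraicGeometry.FundamentalGroup.riemannExistence_qbarDescent_of_finiteIndex :=
    Literature.AlgebraicGeometry.FundamentalGroup.riemannExistence_qbarDescent_of_finiteIndex_of_algebraicSeparating
      hC1'
  -- D: the route decl of stmt-16363 is the named fact with `IsQuasiProjectiveOver` unfolded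
  have hD' : deligne_globalInvariantCycles := hD
  intro X hX hlev c hc
  exact linearSystemTorelli_mem_supportedClasses_one_of_levelZero σ hC hD' (hE σ) hX hlev c hc

/-- **The crux on the level-zero sector from EXISTING ITEMS: stmt-11596 (HC over `ℚ̄`) and
stmt-16363 (Deligne's partie fixe), modulo Riemann existence in relative dimension `≥ 2` (C1'').**
E is supplied by `Theses.PeriodDeficiency.HodgeConjectureQbar` through the discharged Charles–Schnell
`ℚ̄`-support fact (`linearSystemTorelli_qbarDivisorSupport_of_hodgeConjectureQbar`,
`charlesSchnell2014_algebraicClasses_supportedOn_qbarClosed_holds`). So HC(4,2) for fourfolds with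
`h^{4,0} = h^{3,1} = 0` follows from HC(·,2) over `ℚ̄` and the partie fixe, modulo SGA1 XII 5.1 in
dimension `≥ 2`. [cite: Voisin2007HodgeLoci, Prop. 0.7, §3] [cite: CharlesSchnell2014Notes, Thm 11.3.19] -/
theorem linearSystemTorelli_mem_supportedClasses_one_of_levelZero_of_items :
    (∀ (n : ℕ) (S : SchemeOver ℂ), IsAffine S.left → SmoothOfRelativeDimension (n + 2) S.hom →
      IrreducibleSpace S.left →
      ∀ (T : Type) [TopologicalSpace T] (q : T → ComplexPoints S) (_ : IsCoveringMap q)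
        (_ : ∀ t, (q ⁻¹' {t}).Finite) (P₀ : ComplexPoints S),
        ∃ (h : T → ℂ) (F : Polynomial Γ(S.left, ⊤)), Continuous h ∧ F ≠ 0 ∧
          (∀ t, (F.map ((q t).evalRingHom ⊤ trivial)).eval (h t) = 0) ∧
          Set.InjOn h (q ⁻¹' {P₀})) →
    Theses.LinearSystemTorelli.DeligneGlobalInvariantCycles →
    Theses.PeriodDeficiency.HodgeConjectureQbar →
    ∀ ⦃X : SchemeOver ℂ⦄, IsSmoothProjective 4 X →
      (∀ c : complexBetti X 4, IsOfHodgeType 4 X 4 2 2 c) →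
        ∀ (c : complexBetti X 4), IsRationalClass c → c ∈ supportedClasses X 4 1 :=
  fun hC1 h16363 h11596 ↦
    linearSystemTorelli_mem_supportedClasses_one_of_levelZero_of_stubs hC1 h16363
      (linearSystemTorelli_qbarDivisorSupport_of_hodgeConjectureQbar
        charlesSchnell2014_algebraicClasses_supportedOn_qbarClosed_holds h11596)

/-! ### The sector from Hodge numbers: `h^{4,0} = h^{3,1} = 0` -/

/-- **On a Hodge model with `H^{4,0} = H^{3,1} = 0`, `H⁴(X^an; ℂ) = H^{2,2}`**: `H^{0,4} = H^{1,3} = 0`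
by Hodge symmetry (`HodgeModel.hodgePQ_eq_bot_symm`) and `H⁴ = ⨁_{p+q=4} H^{p,q}` by the Hodge
decomposition of the model (`HodgeModel.hodgeFiltration_zero`: the pieces span); the fourfold
analogue of the tree's `HodgeModel.hodgePQ_one_one_eq_top_of_finrank_eq_zero` (`p_g = 0` surfaces).
[cite: VoisinHodgeI2002, Thm. 6.18 and Cor. 6.12] -/
theorem linearSystemTorelli_hodgePQ_two_two_eq_top {n : ℕ} {X : SchemeOver ℂ}
    (hX : IsSmoothProjective n X) (A : HodgeModel n X)
    (h40 : Module.finrank ℂ ↥(A.hodgePQ 4 4 0) = 0) (h31 : Module.finrank ℂ ↥(A.hodgePQ 4 3 1) = 0) :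
    A.hodgePQ 4 2 2 = ⊤ := by
  have h40' : A.hodgePQ 4 4 0 = ⊥ := A.hodgePQ_eq_bot_of_finrank_eq_zero hX h40
  have h04 : A.hodgePQ 4 0 4 = ⊥ := A.hodgePQ_eq_bot_symm h40'
  have h31' : A.hodgePQ 4 3 1 = ⊥ := A.hodgePQ_eq_bot_of_finrank_eq_zero hX h31
  have h13 : A.hodgePQ 4 1 3 = ⊥ := A.hodgePQ_eq_bot_symm h31'
  rw [eq_top_iff, ← A.hodgeFiltration_zero 4]
  refine iSup_le fun p ↦ iSup_le fun q ↦ iSup_le fun hpq ↦ iSup_le fun _ ↦ ?_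
  have hp : p ≤ 4 := by omega
  interval_cases p
  · obtain rfl : q = 4 := by omega
    exact h04 ▸ bot_le
  · obtain rfl : q = 3 := by omega
    exact h13 ▸ bot_le
  · obtain rfl : q = 2 := by omega
    exact le_rfl
  · obtain rfl : q = 1 := by omega
    exact h31' ▸ bot_le
  · obtain rfl : q = 0 := by omega
    exact h40' ▸ bot_le

/-- **`h^{4,0}(X) = h^{3,1}(X) = 0` puts `X` on the level-zero sector**: in the rendering of
`IsOfHodgeType` (an `∃` over Hodge models), a Hodge model `A` of the smooth projective fourfold `X`
with `dim H^{4,0}(A) = dim H^{3,1}(A) = 0` witnesses that EVERY class of `H⁴(X(ℂ); ℂ)` is of type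
`(2,2)`, its `H^{2,2}` being everything. [cite: VoisinHodgeI2002, Thm. 6.18 and Cor. 6.12] -/
theorem linearSystemTorelli_levelZero_of_hodgeNumbers {X : SchemeOver ℂ} (hX : IsSmoothProjective 4 X)
    (A : HodgeModel 4 X) (h40 : Module.finrank ℂ ↥(A.hodgePQ 4 4 0) = 0)
    (h31 : Module.finrank ℂ ↥(A.hodgePQ 4 3 1) = 0) :
    ∀ c : complexBetti X 4, IsOfHodgeType 4 X 4 2 2 c := fun c ↦
  ⟨A, by
    rw [linearSystemTorelli_hodgePQ_two_two_eq_top hX A h40 h31]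
    exact Submodule.mem_top⟩

/-- **HC(4,2)-in-support-form for fourfolds with `h^{4,0} = h^{3,1} = 0`, from EXISTING ITEMS**
(`linearSystemTorelli_mem_supportedClasses_one_of_levelZero_of_items` +
`linearSystemTorelli_levelZero_of_hodgeNumbers`): granted stmt-16363 (partie fixe) and stmt-11596
(HC over `ℚ̄`), modulo Riemann existence in relative dimension `≥ 2` (C1''), every rational class in
`H⁴` of a smooth projective complex fourfold admitting a Hodge model with `dim H^{4,0} = dim H^{3,1} = 0`
lies in `N¹H⁴`. [cite: Voisin2007HodgeLoci, Prop. 0.7, §3] [cite: VoisinHodgeI2002, Thm. 6.18] -/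
theorem linearSystemTorelli_mem_supportedClasses_one_of_hodgeNumbers_of_items
    (hC1 : ∀ (n : ℕ) (S : SchemeOver ℂ), IsAffine S.left → SmoothOfRelativeDimension (n + 2) S.hom →
      IrreducibleSpace S.left →
      ∀ (T : Type) [TopologicalSpace T] (q : T → ComplexPoints S) (_ : IsCoveringMap q)
        (_ : ∀ t, (q ⁻¹' {t}).Finite) (P₀ : ComplexPoints S),
        ∃ (h : T → ℂ) (F : Polynomial Γ(S.left, ⊤)), Continuous h ∧ F ≠ 0 ∧
          (∀ t, (F.map ((q t).evalRingHom ⊤ trivial)).eval (h t) = 0) ∧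
          Set.InjOn h (q ⁻¹' {P₀}))
    (h16363 : Theses.LinearSystemTorelli.DeligneGlobalInvariantCycles)
    (h11596 : Theses.PeriodDeficiency.HodgeConjectureQbar)
    ⦃X : SchemeOver ℂ⦄ (hX : IsSmoothProjective 4 X) (A : HodgeModel 4 X)
    (h40 : Module.finrank ℂ ↥(A.hodgePQ 4 4 0) = 0) (h31 : Module.finrank ℂ ↥(A.hodgePQ 4 3 1) = 0)
    (c : complexBetti X 4) (hc : IsRationalClass c) : c ∈ supportedClasses X 4 1 :=
  linearSystemTorelli_mem_supportedClasses_one_of_levelZero_of_items hC1 h16363 h11596 hX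
    (linearSystemTorelli_levelZero_of_hodgeNumbers hX A h40 h31) c hc

end Summit.HodgeConjecture.HodgeConjecture.Theorems

end
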